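import Mathlib
import HarnessLib

/-!
# Item `LrcModEntire` (stmt-NavierStokesRegularity-20428), skeleton twist_split v6, CLASS road — DEFINITIONS for the similarity change of variables of the
# plane-oscillation law (OSC): `σ(τ) = e^{−τ/2}` (`= √(−t)`), `t(τ) = −e^{−τ}`, `Q(τ,ξ) = σ·O(t(τ), ξσ(τ))`

Cell ns-regularity-ideate, seat ns-k2-port-2 g3 (`--supports stmt-NavierStokesRegularity-20428 --as helper`; statement-only module, the calculus is in
`…TwistingTHOscSimilarityTransform`).  These are the variables in which the endgame `…TwistingTHOscLiouville.eq_zero_of_ancient_oscSubsolution_anyK`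
(LEAD ns-poloidal-K2-p3 g13 ∘ port-2) is stated; `simQ O` is the similarity-variable version of a physical-variable quantity `O(t,z)`, `t < 0`.
WHAT THIS IS NOT: not a claim about Navier–Stokes regularity — three definitions (bears_on LADDER-NS N0, item 20428 / crux 19708).
-/

noncomputable section

-- the summit and its single sub-problem share the name (CONVENTIONS §1), as in every Theorems file
set_option linter.dupNamespace false

namespace Summit.NavierStokesRegularity.NavierStokesRegularity.Theorems.PoloidalWindowDoorLrcModEntireTwistingTHOscSimilarityDefs

/-- `σ(τ) = e^{−τ/2}` — the Type-I length scale `√(−t)` as a function of the similarity time `τ = −log(−t)`. -/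
def sig (τ : ℝ) : ℝ := Real.exp (-(τ / 2))

/-- `t(τ) = −e^{−τ}` — the physical time of the similarity time `τ` (`t < 0`, `−t = σ²`). -/
def tim (τ : ℝ) : ℝ := -Real.exp (-τ)

/-- The similarity-variable version `Q(τ,ξ) = σ(τ)·O(t(τ), ξσ(τ))` of a physical-variable quantity `O(t,z)` (`ξ = z/√(−t)`). -/
def simQ (O : ℝ → ℝ → ℝ) (τ ξ : ℝ) : ℝ := sig τ * O (tim τ) (ξ * sig τ)

end Summit.NavierStokesRegularity.NavierStokesRegularity.Theorems.PoloidalWindowDoorLrcModEntireTwistingTHOscSimilarityDefs
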